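import Literature.Topology.FourManifolds.SphereGenusSplitting
import Literature.Topology.FourManifolds.OneOneHandlebodyBoundary
import HarnessLib

/-!
# The round `4`-sphere splits into a `(1,0,1)`-handlebody and a `(1,1)`-handlebody

Topic `Literature/Topology/FourManifolds` (fact seat
`provefact-Literature.Topology.FourManifolds.exists-762b5f508d` of the named fact
`Literature.Topology.FourManifolds.exists_framedKnot_of_hasHandleDecomposition_oneZeroOne`,
`PropertyRTraceClosing.lean`, whose closing clause (ii) asserts that the round `4`-sphere splits as
`S⁴ = P ∪_{φ'} V'` with `P` the trace of the `0`-framed unknot and `V'` a compact connected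
orientable `(1,1)`-handlebody — R. C. Kirby, *The topology of 4-manifolds*, LNM 1374 (1989), Ch. I
§2, p. 8: *"Adding a 2-handle to an unknot with zero framing gives `S² × B²`"*, and
`S⁴ = ∂(B³ × B²) = S² × B² ∪ S¹ × B³`).  Everything in this file is **proved**; no definition and
no named fact is introduced.

This file supplies the MODEL of that splitting in the tree's Morse-theoretic language: **the round
`4`-sphere is the union, along a regular level, of the sublevel set and the superlevel set of a
Morse function with exactly four critical points, of indices `0, 2` below the level and `3, 4`
above it**; the lower half is then a compact connected orientable `4`-manifold with boundary with a
handle decomposition with one `0`-handle, no `1`-handle and one `2`-handle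
(`HasHandleDecomposition 3 · (1,0,1)`), the upper half — read through the turned-about function —
a compact connected orientable `(1,1)`-handlebody (`HasHandleDecomposition 3 · (handleCount 1 1)`),
and `S⁴` is the boundary gluing of the two (`IsBoundaryGluing … (𝓡 4) (𝕊 4)`).

The construction is the Morse-theoretic stabilisation of `SphereGenusSplitting.lean` (there for
`S³` and index `1/2` births; Juhász, *Differential and Low-Dimensional Topology* (2023), proof of
Thm. 3.33) one dimension up: start from a Morse height function `⟪a, ·⟫` on `𝕊 4` (critical
points the minimum, of index `0`, and the maximum, of index `4`; Milnor, *Morse theory* (1963),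
§6) with the level `0`, and insert ONE pair of critical points of indices `2`, `3` in cancelling
(birth) position near a point of the level (`IsMorse.exists_insert_birthPair`,
`MorseBirthInsertion.lean`: Milnor, *Lectures on the h-cobordism theorem* (1965), Lemma 8.2 and
the proof of Thm. 8.1, PDF pp. 54–56), so close to the level that the new level
`c' = (f' q + f' r)/2` separates `{index ≤ 2}` from `{index ≥ 3}`.  The two halves and the gluing
are then read off `RegularLevelSplitting.lean` (Milnor 1963, Thms. 3.1–3.2; the superlevel set
through `c' - f'`, `MorseTurnAbout.lean`).  No Hessian is computed.

## Main results (all proved)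

* `exists_isMorse_sphereFour_twoThree` — a Morse function on `𝕊 4` with finitely many critical
  points, exactly `1, 0, 1, 1, 1` of them of index `0, 1, 2, 3, 4`, and a level `c` with the
  critical points of index `≤ 2` strictly below and those of index `≥ 3` strictly above.
* `hasHandleDecomposition_regularSublevel_oneZeroOne`,
  `hasHandleDecomposition_regularSuperlevel_oneOne`, `connectedSpace_regularSublevel_of_twoThree`,
  `connectedSpace_regularSuperlevel_of_twoThree` — the two halves.
* `exists_isBoundaryGluing_sphereFour_oneZeroOne_oneOne` — **the splitting
  `S⁴ = P₀ ∪ V₀`**: a compact connected orientable `(1,0,1)`-handlebody `P₀`, a compact connected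
  orientable `(1,1)`-handlebody `V₀` (both in `Type`, Hausdorff, second countable), boundary data
  and a diffeomorphism `φ₀ : ∂P₀ ≅ ∂V₀` with `IsBoundaryGluing bP₀ bV₀ φ₀ (𝓡 4) (𝕊 4)`; together
  with the presenting Morse function (`exists_regularSublevel_sphereFour_oneZeroOne_oneOne`, the
  same with `P₀ = {f ≤ c}`, `V₀ = {c ≤ f}` explicit).
* `exists_isBoundaryGluing_sphereFour_of_diffeomorph_regularSublevel`,
  `exists_model_forall_diffeomorph_isBoundaryGluing_sphereFour` — **the conclusion of clause (ii)
  of the fact for every `P` diffeomorphic to the model lower half** (transport of the splitting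
  along the diffeomorphism, `IsBoundaryGluing.transfer`): what then remains of clause (ii) is a
  diffeomorphism `P ≅ P₀`.
* `eq_zero_of_isIntegralSurgery_boundary_regularSublevel` — the boundary of the model lower half
  is `S² × S¹`, so every integral surgery presenting it has framing `0` (homological half of the
  certification of the model's attaching data).

## References

* R. C. Kirby, *The topology of 4-manifolds*, LNM 1374 (1989), Ch. I §2, p. 8. [Kirby1989]
* J. Milnor, *Lectures on the h-cobordism theorem* (1965), Lemma 8.2 and proof of Thm. 8.1
  (PDF pp. 54–56). [MilnorHCobordism1965]
* J. Milnor, *Morse theory* (1963), §3 (Thms. 3.1–3.2) and §6. [Milnor1963]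
* A. Juhász, *Differential and Low-Dimensional Topology* (2023), proof of Thm. 3.33 (p. 98).
  [Juhasz2023]
-/

open scoped Manifold ContDiff Topology
open Set Function

noncomputable section

namespace Literature.Topology.FourManifolds

/-! ### A Morse function on `S⁴` with critical points of indices `0, 2 | 3, 4` -/

section MorseFunction

/-- **A Morse function on the round `4`-sphere with four critical points, of indices `0, 2` below
a regular level and `3, 4` above it**: a Morse height function (Milnor 1963, §6) with one birth
pair of indices `2, 3` inserted near a point of the level `0` (Milnor 1965, Lemma 8.2 and proof
of Thm. 8.1).  The conclusion lists: `f` Morse with finitely many critical points; exactly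
`1, 0, 1, 1, 1` critical points of index `0, 1, 2, 3, 4`; the critical points of index `≤ 2` lie
strictly below `c`, those of index `≥ 3` strictly above. [cite: MilnorHCobordism1965, Lemma 8.2 and proof of Thm. 8.1 (PDF pp. 54–56)]
[cite: Milnor1963, §6] -/
theorem exists_isMorse_sphereFour_twoThree :
    ∃ (f : (Metric.sphere (0 : EuclideanSpace ℝ (Fin 5)) 1) → ℝ) (c : ℝ),
      IsMorse (𝓡 4) f ∧ (criticalSet (𝓡 4) f).Finite ∧
      (criticalSetOfIndex (𝓡 4) f 0).ncard = 1 ∧ (criticalSetOfIndex (𝓡 4) f 1).ncard = 0 ∧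
      (criticalSetOfIndex (𝓡 4) f 2).ncard = 1 ∧ (criticalSetOfIndex (𝓡 4) f 3).ncard = 1 ∧
      (criticalSetOfIndex (𝓡 4) f 4).ncard = 1 ∧
      (∀ x, IsMCriticalPt (𝓡 4) f x → morseIndex (𝓡 4) f x ≤ 2 → f x < c) ∧
      (∀ x, IsMCriticalPt (𝓡 4) f x → 3 ≤ morseIndex (𝓡 4) f x → c < f x) := by
  haveI : PreconnectedSpace (Metric.sphere (0 : EuclideanSpace ℝ (Fin 5)) 1) := by
    have h : IsPreconnected (Metric.sphere (0 : EuclideanSpace ℝ (Fin 5)) 1) := by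
      apply isPreconnected_sphere
      rw [← Module.finrank_eq_rank, finrank_euclideanSpace_fin]
      norm_num
    exact isPreconnected_iff_preconnectedSpace.mp h
  -- the height function
  obtain ⟨a, ha, hf⟩ := SphereHeight.exists_isMorse_height 4
  have hcrit := SphereHeight.criticalSet_height (n := 4) ha
  have hi0 := SphereHeight.morseIndex_bot (n := 4) ha hf
  have hi4 := SphereHeight.morseIndex_top (n := 4) ha hf
  have hne := SphereHeight.top_ne_bot (n := 4) ha
  have hapos : 0 < ‖a‖ := norm_pos_iff.2 ha
  set F := SphereHeight.height (n := 4) a with hF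
  have hmem : ∀ x, x ∈ criticalSet (𝓡 4) F ↔
      x = SphereHeight.top ha ∨ x = SphereHeight.bot ha := fun x => by
    rw [hcrit]; simp
  -- a point of the level `0`, regular
  obtain ⟨z, hz⟩ : (0 : ℝ) ∈ range F := by
    have hIVT := intermediate_value_univ (SphereHeight.bot ha) (SphereHeight.top ha) hf.1.continuous
    refine hIVT ⟨?_, ?_⟩
    · show F (SphereHeight.bot ha) ≤ 0
      rw [hF, SphereHeight.height_bot]; linarith
    · show 0 ≤ F (SphereHeight.top ha)
      rw [hF, SphereHeight.height_top]; linarith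
  have hreg : ¬ IsMCriticalPt (𝓡 4) F z := fun hc => by
    rcases (hmem z).1 hc with h | h
    · rw [h, hF, SphereHeight.height_top] at hz; linarith
    · rw [h, hF, SphereHeight.height_bot] at hz; linarith
  -- insert a birth pair of indices `2`, `3` within `δ = ‖a‖/3` of the level `0`
  set δ : ℝ := ‖a‖ / 3 with hδ
  have hδpos : 0 < δ := by positivity
  set U : Set (Metric.sphere (0 : EuclideanSpace ℝ (Fin 5)) 1) := F ⁻¹' Ioo (0 - δ) (0 + δ) with hU
  have hUz : U ∈ 𝓝 z :=
    hf.1.continuous.continuousAt.preimage_mem_nhds (Ioo_mem_nhds (by linarith) (by linarith))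
  obtain ⟨f', hf'M, -, hε', hev, hidx, q, r, hqU, hrU, hqr, hq, hr, hcrit', hiq, hir, hlt⟩ :=
    hf.exists_insert_birthPair (isInteriorPoint_euclidean z) hreg hUz (k := 2) (by norm_num) hδpos
  have hold : ∀ x ∈ criticalSet (𝓡 4) F, f' x = F x := fun x hx => (hev x hx).eq_of_nhds
  have hfq : F q ∈ Ioo (0 - δ) (0 + δ) := hqU
  have hfr : F r ∈ Ioo (0 - δ) (0 + δ) := hrU
  have hq' := abs_sub_lt_iff.1 (hε' q)
  have hr' := abs_sub_lt_iff.1 (hε' r)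
  set c : ℝ := (f' q + f' r) / 2 with hc
  have hc₁ : -(2 * δ) < c := by rw [hc]; linarith [hfq.1, hfr.1, hq'.1, hq'.2, hr'.1, hr'.2]
  have hc₂ : c < 2 * δ := by rw [hc]; linarith [hfq.2, hfr.2, hq'.1, hq'.2, hr'.1, hr'.2]
  have hmem' := mem_criticalSetOfIndex_iff_of_insert hcrit' hidx hiq hir hq hr
  have htopS : SphereHeight.top ha ∈ criticalSet (𝓡 4) F := (hmem _).2 (Or.inl rfl)
  have hbotS : SphereHeight.bot ha ∈ criticalSet (𝓡 4) F := (hmem _).2 (Or.inr rfl)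
  -- the old critical sets of each index
  have hold0 : criticalSetOfIndex (𝓡 4) F 0 = {SphereHeight.bot ha} := by
    ext x
    simp only [mem_criticalSetOfIndex, ← mem_criticalSet, hmem, mem_singleton_iff]
    constructor
    · rintro ⟨rfl | rfl, hi⟩
      · rw [hi4] at hi; omega
      · rfl
    · rintro rfl; exact ⟨Or.inr rfl, hi0⟩
  have hold4 : criticalSetOfIndex (𝓡 4) F 4 = {SphereHeight.top ha} := by
    ext x
    simp only [mem_criticalSetOfIndex, ← mem_criticalSet, hmem, mem_singleton_iff]
    constructor
    · rintro ⟨rfl | rfl, hi⟩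
      · rfl
      · rw [hi0] at hi; omega
    · rintro rfl; exact ⟨Or.inl rfl, hi4⟩
  have holdi : ∀ {i : ℕ}, i ≠ 0 → i ≠ 4 → criticalSetOfIndex (𝓡 4) F i = ∅ := fun {i} h0 h4 => by
    ext x
    simp only [mem_criticalSetOfIndex, ← mem_criticalSet, hmem, mem_empty_iff_false, iff_false,
      not_and]
    rintro (rfl | rfl)
    · rw [hi4]; exact fun h => h4 h.symm
    · rw [hi0]; exact fun h => h0 h.symm
  refine ⟨f', c, hf'M, ?_, ?_, ?_, ?_, ?_, ?_, ?_, ?_⟩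
  · rw [hcrit', hcrit]; exact (((finite_singleton _).insert _).insert r).insert q
  · have he : criticalSetOfIndex (𝓡 4) f' 0 = criticalSetOfIndex (𝓡 4) F 0 := by
      ext x; rw [hmem']; simp
    rw [he, hold0, ncard_singleton]
  · have he : criticalSetOfIndex (𝓡 4) f' 1 = criticalSetOfIndex (𝓡 4) F 1 := by
      ext x; rw [hmem']; simp
    rw [he, holdi one_ne_zero (by norm_num), ncard_empty]
  · have he : criticalSetOfIndex (𝓡 4) f' 2 = insert q (criticalSetOfIndex (𝓡 4) F 2) := by
      ext x; rw [hmem', mem_insert_iff]; simp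
    rw [he, holdi two_ne_zero (by norm_num), insert_empty_eq, ncard_singleton]
  · have he : criticalSetOfIndex (𝓡 4) f' 3 = insert r (criticalSetOfIndex (𝓡 4) F 3) := by
      ext x; rw [hmem', mem_insert_iff]; simp
    rw [he, holdi three_ne_zero (by norm_num), insert_empty_eq, ncard_singleton]
  · have he : criticalSetOfIndex (𝓡 4) f' 4 = criticalSetOfIndex (𝓡 4) F 4 := by
      ext x; rw [hmem']; simp
    rw [he, hold4, ncard_singleton]
  · intro x hx hi
    have hx' : x ∈ criticalSet (𝓡 4) f' := hx
    rw [hcrit'] at hx'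
    rcases hx' with rfl | rfl | hxS
    · rw [hc]; linarith
    · rw [hir] at hi; omega
    · rcases (hmem x).1 hxS with rfl | rfl
      · rw [hidx _ htopS, hi4] at hi; omega
      · rw [hold _ hbotS, hF, SphereHeight.height_bot]; linarith
  · intro x hx hi
    have hx' : x ∈ criticalSet (𝓡 4) f' := hx
    rw [hcrit'] at hx'
    rcases hx' with rfl | rfl | hxS
    · rw [hiq] at hi; omega
    · rw [hc]; linarith
    · rcases (hmem x).1 hxS with rfl | rfl
      · rw [hold _ htopS, hF, SphereHeight.height_top]; linarith
      · rw [hidx _ hbotS, hi0] at hi; omega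

end MorseFunction

/-! ### The two halves of the splitting -/

section Halves

variable {f : (Metric.sphere (0 : EuclideanSpace ℝ (Fin 5)) 1) → ℝ} {c : ℝ}

/-- **The lower half `{f ≤ c}` is a `(1,0,1)`-handlebody**: for a Morse function on `𝕊 4` with
`1, 0, 1` critical points of index `0, 1, 2`, all strictly below the regular level `c`, and all
critical points of index `≥ 3` strictly above it, the adapted Morse function `f|{f ≤ c} + (1 - c)`
(`RegularSublevel.hasHandleDecomposition`; Milnor 1963, Thms. 3.1–3.2) has exactly one critical
point of index `0`, one of index `2` and no other. [cite: Milnor1963, Thms. 3.1–3.2] -/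
theorem hasHandleDecomposition_regularSublevel_oneZeroOne (hf : IsMorse (𝓡 4) f)
    (h : IsRegularLevel (𝓡 4) f c)
    (h0 : (criticalSetOfIndex (𝓡 4) f 0).ncard = 1) (h1 : (criticalSetOfIndex (𝓡 4) f 1).ncard = 0)
    (h2 : (criticalSetOfIndex (𝓡 4) f 2).ncard = 1)
    (hbelow : ∀ x, IsMCriticalPt (𝓡 4) f x → morseIndex (𝓡 4) f x ≤ 2 → f x < c)
    (habove : ∀ x, IsMCriticalPt (𝓡 4) f x → 3 ≤ morseIndex (𝓡 4) f x → c < f x) :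
    HasHandleDecomposition 3 (RegularSublevel h)
      (fun k => if k = 0 then 1 else if k = 2 then 1 else 0) := by
  have hd := RegularSublevel.hasHandleDecomposition hf h
  have hfun : (fun i => (criticalSetOfIndex (𝓡 4) f i ∩ f ⁻¹' Iic c).ncard) =
      fun k => if k = 0 then 1 else if k = 2 then 1 else 0 := by
    funext i
    rcases Nat.lt_or_ge i 3 with hi | hi
    · have he : criticalSetOfIndex (𝓡 4) f i ∩ f ⁻¹' Iic c = criticalSetOfIndex (𝓡 4) f i := by
        refine inter_eq_left.2 fun x hx => ?_
        exact (hbelow x hx.1 (by rw [hx.2]; omega)).le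
      rw [he]
      interval_cases i
      · rw [h0]; rfl
      · rw [h1]; rfl
      · rw [h2]; rfl
    · have he : criticalSetOfIndex (𝓡 4) f i ∩ f ⁻¹' Iic c = ∅ := by
        refine eq_empty_of_forall_notMem fun x hx => ?_
        have h2 := habove x hx.1.1 (by rw [hx.1.2]; exact hi)
        have h3 : f x ≤ c := hx.2
        exact absurd h3 (not_le.2 h2)
      rw [he, ncard_empty, if_neg (by omega), if_neg (by omega)]
  rw [hfun] at hd
  exact hd

/-- **The upper half `{c ≤ f}` is a `(1,1)`-handlebody**: with `1, 1` critical points of index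
`3, 4` strictly above the regular level `c` and those of index `≤ 2` strictly below, the adapted
Morse function `c + 1 - f` of the superlevel set has critical points of index `i` those of `f` of
index `4 - i` above `c` (`IsMorse.criticalSetOfIndex_const_sub`), i.e. one of index `0` and one of
index `1`. [cite: Milnor1963, Thms. 3.1–3.2] [cite: Kirby1989, Ch. I §2, p. 8] -/
theorem hasHandleDecomposition_regularSuperlevel_oneOne (hf : IsMorse (𝓡 4) f)
    (h : IsRegularLevel (𝓡 4) f c)
    (h3 : (criticalSetOfIndex (𝓡 4) f 3).ncard = 1) (h4 : (criticalSetOfIndex (𝓡 4) f 4).ncard = 1)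
    (hbelow : ∀ x, IsMCriticalPt (𝓡 4) f x → morseIndex (𝓡 4) f x ≤ 2 → f x < c)
    (habove : ∀ x, IsMCriticalPt (𝓡 4) f x → 3 ≤ morseIndex (𝓡 4) f x → c < f x) :
    HasHandleDecomposition 3 (RegularSuperlevel h) (handleCount 1 1) := by
  have hd := RegularSublevel.hasHandleDecomposition (hf.const_sub c) h.const_sub
  have hrank : Module.finrank ℝ (EuclideanSpace ℝ (Fin 4)) = 4 := finrank_euclideanSpace_fin
  have hcs : ∀ {i : ℕ}, i ≤ 4 → criticalSetOfIndex (𝓡 4) (fun y => c - f y) i =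
      criticalSetOfIndex (𝓡 4) f (4 - i) := fun {i} hi => by
    rw [hf.criticalSetOfIndex_const_sub c (by rw [hrank]; exact hi), hrank]
  -- below the new level `0` of `c - f` lie exactly the critical points of `f` of index `≥ 3`
  have hfull : ∀ {j : ℕ}, 3 ≤ j → criticalSetOfIndex (𝓡 4) f j ∩
      (fun y => c - f y) ⁻¹' Iic (0 : ℝ) = criticalSetOfIndex (𝓡 4) f j := fun {j} hj => by
    refine inter_eq_left.2 fun x hx => ?_
    have h2 := habove x hx.1 (by rw [hx.2]; exact hj)
    show c - f x ≤ 0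
    linarith
  have hempty : ∀ {j : ℕ}, j ≤ 2 → criticalSetOfIndex (𝓡 4) f j ∩
      (fun y => c - f y) ⁻¹' Iic (0 : ℝ) = ∅ := fun {j} hj => by
    refine eq_empty_of_forall_notMem fun x hx => ?_
    have h2 := hbelow x hx.1.1 (by rw [hx.1.2]; exact hj)
    have h3 : c - f x ≤ 0 := hx.2
    linarith
  have hfun : (fun i => (criticalSetOfIndex (𝓡 4) (fun y => c - f y) i ∩
      (fun y => c - f y) ⁻¹' Iic (0 : ℝ)).ncard) = handleCount 1 1 := by
    funext i
    rcases Nat.lt_or_ge i 5 with hi | hi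
    · interval_cases i
      · rw [hcs (by norm_num), show (4 : ℕ) - 0 = 4 from rfl, hfull (by norm_num), h4]
        rfl
      · rw [hcs (by norm_num), show (4 : ℕ) - 1 = 3 from rfl, hfull (by norm_num), h3]
        rfl
      · rw [hcs (by norm_num), show (4 : ℕ) - 2 = 2 from rfl, hempty (by norm_num), ncard_empty]
        rfl
      · rw [hcs (by norm_num), show (4 : ℕ) - 3 = 1 from rfl, hempty (by norm_num), ncard_empty]
        rfl
      · rw [hcs (by norm_num), show (4 : ℕ) - 4 = 0 from rfl, hempty (by norm_num), ncard_empty]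
        rfl
    · rw [criticalSetOfIndex_eq_empty_of_finrank_lt (by rw [hrank]; omega), empty_inter,
        ncard_empty, handleCount, if_neg (by omega), if_neg (by omega)]
  rw [hfun] at hd
  exact hd

/-- The lower half `{f ≤ c}` is connected (one critical point of index `0`, below `c`; Reeb's
argument, `RegularSublevel.connectedSpace`). [cite: Milnor1963, §3 and proof of Thm. 4.1] -/
theorem connectedSpace_regularSublevel_of_twoThree (h : IsRegularLevel (𝓡 4) f c)
    (h0 : (criticalSetOfIndex (𝓡 4) f 0).ncard = 1)
    (hbelow : ∀ x, IsMCriticalPt (𝓡 4) f x → morseIndex (𝓡 4) f x ≤ 2 → f x < c) :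
    ConnectedSpace (RegularSublevel h) := by
  obtain ⟨x₀, hx₀⟩ := Set.ncard_eq_one.1 h0
  have hmem : x₀ ∈ criticalSetOfIndex (𝓡 4) f 0 := by rw [hx₀]; exact mem_singleton _
  have h0' : (criticalSetOfIndex (𝓡 4) f 0).Subsingleton := by rw [hx₀]; exact subsingleton_singleton
  exact RegularSublevel.connectedSpace h h0'
    ⟨x₀, (hbelow x₀ hmem.1 (by rw [hmem.2]; norm_num)).le⟩

/-- The upper half `{c ≤ f}` is connected (one critical point of top index `4`, above `c`;
`RegularSublevel.connectedSpace_superlevel`). [cite: Milnor1963, §3 and proof of Thm. 4.1] -/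
theorem connectedSpace_regularSuperlevel_of_twoThree (hf : IsMorse (𝓡 4) f)
    (h : IsRegularLevel (𝓡 4) f c) (h4 : (criticalSetOfIndex (𝓡 4) f 4).ncard = 1)
    (habove : ∀ x, IsMCriticalPt (𝓡 4) f x → 3 ≤ morseIndex (𝓡 4) f x → c < f x) :
    ConnectedSpace (RegularSuperlevel h) := by
  obtain ⟨x₄, hx₄⟩ := Set.ncard_eq_one.1 h4
  have hmem : x₄ ∈ criticalSetOfIndex (𝓡 4) f 4 := by rw [hx₄]; exact mem_singleton _
  have h4' : (criticalSetOfIndex (𝓡 4) f (3 + 1)).Subsingleton := by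
    rw [show (3 : ℕ) + 1 = 4 from rfl, hx₄]; exact subsingleton_singleton
  exact RegularSublevel.connectedSpace_superlevel hf h h4'
    ⟨x₄, (habove x₄ hmem.1 (by rw [hmem.2]; norm_num)).le⟩

end Halves

/-! ### The splitting of the round `4`-sphere -/

section Sphere

/-- **`S⁴ = {f ≤ c} ∪_{f⁻¹(c)} {c ≤ f}`, a `(1,0,1)`-handlebody glued to a `(1,1)`-handlebody**
(explicit form): for the Morse function of `exists_isMorse_sphereFour_twoThree` and its separating
regular level `c`, the sublevel set `P₀ = {f ≤ c}` is a compact connected orientable `4`-manifold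
with boundary with a handle decomposition with one `0`-handle, no `1`-handle and one `2`-handle,
the superlevel set `V₀ = {c ≤ f}` is a compact connected orientable `(1,1)`-handlebody, and the
round sphere is their gluing along the level (`RegularSublevel.isBoundaryGluing_split`).  This is
the handle form of `S⁴ = S² × B² ∪ S¹ × B³` (Kirby 1989, Ch. I §2, p. 8).
[cite: Kirby1989, Ch. I §2, p. 8] [cite: Milnor1963, Thms. 3.1–3.2] -/
theorem exists_regularSublevel_sphereFour_oneZeroOne_oneOne :
    ∃ (f : (Metric.sphere (0 : EuclideanSpace ℝ (Fin 5)) 1) → ℝ) (c : ℝ) (_ : IsMorse (𝓡 4) f)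
      (h : IsRegularLevel (𝓡 4) f c),
      (criticalSet (𝓡 4) f).Finite ∧
      (criticalSetOfIndex (𝓡 4) f 0).ncard = 1 ∧ (criticalSetOfIndex (𝓡 4) f 1).ncard = 0 ∧
      (criticalSetOfIndex (𝓡 4) f 2).ncard = 1 ∧ (criticalSetOfIndex (𝓡 4) f 3).ncard = 1 ∧
      (criticalSetOfIndex (𝓡 4) f 4).ncard = 1 ∧
      (∀ x, IsMCriticalPt (𝓡 4) f x → morseIndex (𝓡 4) f x ≤ 2 → f x < c) ∧
      (∀ x, IsMCriticalPt (𝓡 4) f x → 3 ≤ morseIndex (𝓡 4) f x → c < f x) ∧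
      HasHandleDecomposition 3 (RegularSublevel h)
        (fun k => if k = 0 then 1 else if k = 2 then 1 else 0) ∧
      HasHandleDecomposition 3 (RegularSuperlevel h) (handleCount 1 1) ∧
      ConnectedSpace (RegularSublevel h) ∧ ConnectedSpace (RegularSuperlevel h) ∧
      IsOrientable (𝓡∂ 4) (RegularSublevel h) ∧ IsOrientable (𝓡∂ 4) (RegularSuperlevel h) ∧
      IsBoundaryGluing (RegularSublevel.boundaryData h) (RegularSublevel.boundaryData h.const_sub)
        (RegularSublevel.splitDiffeomorph h) (𝓡 4) (Metric.sphere (0 : EuclideanSpace ℝ (Fin 5)) 1) := by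
  obtain ⟨f, c, hf, hfin, h0, h1, h2, h3, h4, hbelow, habove⟩ := exists_isMorse_sphereFour_twoThree
  have hne : ∀ x, IsMCriticalPt (𝓡 4) f x → f x ≠ c := fun x hx => by
    rcases Nat.lt_or_ge (morseIndex (𝓡 4) f x) 3 with hi | hi
    · exact (hbelow x hx (by omega)).ne
    · exact (habove x hx hi).ne'
  have h : IsRegularLevel (𝓡 4) f c := hf.isRegularLevel hne
  have hY : IsOrientable (𝓡 4) (Metric.sphere (0 : EuclideanSpace ℝ (Fin 5)) 1) :=
    isOrientable_sphere_holds 4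
  exact ⟨f, c, hf, h, hfin, h0, h1, h2, h3, h4, hbelow, habove,
    hasHandleDecomposition_regularSublevel_oneZeroOne hf h h0 h1 h2 hbelow habove,
    hasHandleDecomposition_regularSuperlevel_oneOne hf h h3 h4 hbelow habove,
    connectedSpace_regularSublevel_of_twoThree h h0 hbelow,
    connectedSpace_regularSuperlevel_of_twoThree hf h h4 habove,
    RegularSublevel.isOrientable h hY, RegularSublevel.isOrientable h.const_sub hY,
    RegularSublevel.isBoundaryGluing_split h⟩

/-- **The round `4`-sphere is the gluing of a compact connected orientable `(1,0,1)`-handlebody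
and a compact connected orientable `(1,1)`-handlebody along their boundaries** — the model
splitting `S⁴ = S² × B² ∪ S¹ × B³` of Kirby (1989), Ch. I §2, p. 8, in the language of the named
fact `exists_framedKnot_of_hasHandleDecomposition_oneZeroOne` (clause (ii)): there are `P₀`, `V₀`
(in `Type`, Hausdorff, second countable, compact, connected, orientable), with
`HasHandleDecomposition 3 P₀ (1,0,1)`, `HasHandleDecomposition 3 V₀ (handleCount 1 1)`, boundary
data `bP₀`, `bV₀` and a diffeomorphism `φ₀ : bP₀.carrier ≅ bV₀.carrier` with
`IsBoundaryGluing bP₀ bV₀ φ₀ (𝓡 4) (𝕊 4)`. [cite: Kirby1989, Ch. I §2, p. 8] -/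
theorem exists_isBoundaryGluing_sphereFour_oneZeroOne_oneOne :
    ∃ (P₀ : Type) (_ : TopologicalSpace P₀) (_ : T2Space P₀) (_ : SecondCountableTopology P₀)
      (_ : ChartedSpace (EuclideanHalfSpace 4) P₀) (_ : IsManifold (𝓡∂ 4) ∞ P₀)
      (_ : CompactSpace P₀) (_ : ConnectedSpace P₀)
      (V₀ : Type) (_ : TopologicalSpace V₀) (_ : T2Space V₀) (_ : SecondCountableTopology V₀)
      (_ : ChartedSpace (EuclideanHalfSpace 4) V₀) (_ : IsManifold (𝓡∂ 4) ∞ V₀)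
      (_ : CompactSpace V₀) (_ : ConnectedSpace V₀)
      (bP₀ : BoundaryData (𝓡∂ 4) P₀ (𝓡 3)) (bV₀ : BoundaryData (𝓡∂ 4) V₀ (𝓡 3))
      (φ₀ : bP₀.carrier ≃ₘ⟮𝓡 3, 𝓡 3⟯ bV₀.carrier),
      HasHandleDecomposition 3 P₀ (fun k => if k = 0 then 1 else if k = 2 then 1 else 0) ∧
        HasHandleDecomposition 3 V₀ (handleCount 1 1) ∧
        IsOrientable (𝓡∂ 4) P₀ ∧ IsOrientable (𝓡∂ 4) V₀ ∧
        IsBoundaryGluing bP₀ bV₀ φ₀ (𝓡 4) (Metric.sphere (0 : EuclideanSpace ℝ (Fin 5)) 1) := by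
  obtain ⟨f, c, hf, h, -, -, -, -, -, -, -, -, hP, hV, hcP, hcV, hoP, hoV, hglue⟩ :=
    exists_regularSublevel_sphereFour_oneZeroOne_oneOne
  exact ⟨RegularSublevel h, inferInstance, inferInstance, inferInstance, inferInstance, inferInstance,
    inferInstance, hcP, RegularSuperlevel h, inferInstance, inferInstance, inferInstance,
    inferInstance, inferInstance, inferInstance, hcV, RegularSublevel.boundaryData h,
    RegularSublevel.boundaryData h.const_sub, RegularSublevel.splitDiffeomorph h, hP, hV, hoP, hoV,
    hglue⟩

end Sphere

/-! ### Closing up any manifold diffeomorphic to the lower half -/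

section Closing

/-- **Every compact `4`-manifold with boundary diffeomorphic to the lower half `{f ≤ c}` of such a
splitting closes up to the round `4`-sphere with a `(1,1)`-handlebody complement** — the
conclusion of clause (ii) of the named fact
`exists_framedKnot_of_hasHandleDecomposition_oneZeroOne` for it: given a Morse function `f` on
`𝕊 4` and a regular level `c` with one critical point of index `3` and one of index `4` strictly
above `c` and all critical points of index `≤ 2` strictly below, every `P` with a diffeomorphism
`e : P ≅ {f ≤ c}` and every boundary datum `bP` of `P` admit `V' = {c ≤ f}` (compact, connected,
orientable, `HasHandleDecomposition 3 V' (handleCount 1 1)`), its boundary datum and the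
diffeomorphism `φ' = split ∘ ∂e : bP.carrier ≅ ∂V'` with `IsBoundaryGluing bP bV' φ' (𝓡 4) (𝕊 4)`
(transport of `RegularSublevel.isBoundaryGluing_split` along `e`, `IsBoundaryGluing.transfer`;
Lee 2013, Thm. 5.11 for the restriction of `e` to the boundaries).  This reduces clause (ii) to
a diffeomorphism `P ≅ {f ≤ c}` with the model. [cite: Kirby1989, Ch. I §2, p. 8]
[cite: Milnor1963, Thms. 3.1–3.2] -/
theorem exists_isBoundaryGluing_sphereFour_of_diffeomorph_regularSublevel
    {f : (Metric.sphere (0 : EuclideanSpace ℝ (Fin 5)) 1) → ℝ} {c : ℝ} (hf : IsMorse (𝓡 4) f)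
    (h : IsRegularLevel (𝓡 4) f c)
    (h3 : (criticalSetOfIndex (𝓡 4) f 3).ncard = 1) (h4 : (criticalSetOfIndex (𝓡 4) f 4).ncard = 1)
    (hbelow : ∀ x, IsMCriticalPt (𝓡 4) f x → morseIndex (𝓡 4) f x ≤ 2 → f x < c)
    (habove : ∀ x, IsMCriticalPt (𝓡 4) f x → 3 ≤ morseIndex (𝓡 4) f x → c < f x)
    (P : Type) [TopologicalSpace P] [ChartedSpace (EuclideanHalfSpace 4) P] [IsManifold (𝓡∂ 4) ∞ P]
    (bP : BoundaryData (𝓡∂ 4) P (𝓡 3)) (e : P ≃ₘ⟮𝓡∂ 4, 𝓡∂ 4⟯ RegularSublevel h) :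
    ∃ (V' : Type) (_ : TopologicalSpace V') (_ : T2Space V') (_ : SecondCountableTopology V')
      (_ : ChartedSpace (EuclideanHalfSpace 4) V') (_ : IsManifold (𝓡∂ 4) ∞ V')
      (_ : CompactSpace V') (_ : ConnectedSpace V') (bV' : BoundaryData (𝓡∂ 4) V' (𝓡 3))
      (φ' : bP.carrier ≃ₘ⟮𝓡 3, 𝓡 3⟯ bV'.carrier),
      HasHandleDecomposition 3 V' (handleCount 1 1) ∧ IsOrientable (𝓡∂ 4) V' ∧
        IsBoundaryGluing bP bV' φ' (𝓡 4) (Metric.sphere (0 : EuclideanSpace ℝ (Fin 5)) 1) := by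
  have hY : IsOrientable (𝓡 4) (Metric.sphere (0 : EuclideanSpace ℝ (Fin 5)) 1) :=
    isOrientable_sphere_holds 4
  have hglue := (RegularSublevel.isBoundaryGluing_split h).transfer (b₁ := bP) e
  exact ⟨RegularSuperlevel h, inferInstance, inferInstance, inferInstance, inferInstance, inferInstance,
    inferInstance, connectedSpace_regularSuperlevel_of_twoThree hf h h4 habove,
    RegularSublevel.boundaryData h.const_sub,
    (bP.restrictDiffeomorph (RegularSublevel.boundaryData h) e).trans (RegularSublevel.splitDiffeomorph h),
    hasHandleDecomposition_regularSuperlevel_oneOne hf h h3 h4 hbelow habove,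
    RegularSublevel.isOrientable h.const_sub hY, by rw [Diffeomorph.coe_trans]; exact hglue⟩

/-- **The model lower half, universally**: there are a Morse function `f` on `𝕊 4` and a regular
level `c` as in `exists_regularSublevel_sphereFour_oneZeroOne_oneOne` — so that `P₀ = {f ≤ c}` is
a compact connected orientable `(1,0,1)`-handlebody presented by the adapted Morse function
`f|P₀ + (1 - c)` (`RegularSublevel.morseData`) — such that **every** `4`-manifold with boundary
`P` diffeomorphic to `P₀`, with any boundary datum, closes up to the round `S⁴` with a compact
connected orientable `(1,1)`-handlebody complement.  What remains of clause (ii) of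
`exists_framedKnot_of_hasHandleDecomposition_oneZeroOne` after this is the diffeomorphism
`P ≅ P₀` for the trace `P` of the `0`-framed unknot (uniqueness of attaching one `2`-handle,
Kosinski 1993, VI (6.6), (7.2)). [cite: Kirby1989, Ch. I §2, p. 8] [cite: Milnor1963, Thms. 3.1–3.2] -/
theorem exists_model_forall_diffeomorph_isBoundaryGluing_sphereFour :
    ∃ (f : (Metric.sphere (0 : EuclideanSpace ℝ (Fin 5)) 1) → ℝ) (c : ℝ) (_ : IsMorse (𝓡 4) f)
      (h : IsRegularLevel (𝓡 4) f c),
      (criticalSet (𝓡 4) f).Finite ∧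
      (criticalSetOfIndex (𝓡 4) f 0).ncard = 1 ∧ (criticalSetOfIndex (𝓡 4) f 1).ncard = 0 ∧
      (criticalSetOfIndex (𝓡 4) f 2).ncard = 1 ∧ (criticalSetOfIndex (𝓡 4) f 3).ncard = 1 ∧
      (criticalSetOfIndex (𝓡 4) f 4).ncard = 1 ∧
      (∀ x, IsMCriticalPt (𝓡 4) f x → morseIndex (𝓡 4) f x ≤ 2 → f x < c) ∧
      (∀ x, IsMCriticalPt (𝓡 4) f x → 3 ≤ morseIndex (𝓡 4) f x → c < f x) ∧
      HasHandleDecomposition 3 (RegularSublevel h)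
        (fun k => if k = 0 then 1 else if k = 2 then 1 else 0) ∧
      ConnectedSpace (RegularSublevel h) ∧ IsOrientable (𝓡∂ 4) (RegularSublevel h) ∧
      ∀ (P : Type) [TopologicalSpace P] [ChartedSpace (EuclideanHalfSpace 4) P]
        [IsManifold (𝓡∂ 4) ∞ P] (bP : BoundaryData (𝓡∂ 4) P (𝓡 3)),
        Nonempty (P ≃ₘ⟮𝓡∂ 4, 𝓡∂ 4⟯ RegularSublevel h) →
        ∃ (V' : Type) (_ : TopologicalSpace V') (_ : T2Space V') (_ : SecondCountableTopology V')
          (_ : ChartedSpace (EuclideanHalfSpace 4) V') (_ : IsManifold (𝓡∂ 4) ∞ V')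
          (_ : CompactSpace V') (_ : ConnectedSpace V') (bV' : BoundaryData (𝓡∂ 4) V' (𝓡 3))
          (φ' : bP.carrier ≃ₘ⟮𝓡 3, 𝓡 3⟯ bV'.carrier),
          HasHandleDecomposition 3 V' (handleCount 1 1) ∧ IsOrientable (𝓡∂ 4) V' ∧
            IsBoundaryGluing bP bV' φ' (𝓡 4) (Metric.sphere (0 : EuclideanSpace ℝ (Fin 5)) 1) := by
  obtain ⟨f, c, hf, h, hfin, h0, h1, h2, h3, h4, hbelow, habove, hP, -, hcP, -, hoP, -, -⟩ :=
    exists_regularSublevel_sphereFour_oneZeroOne_oneOne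
  exact ⟨f, c, hf, h, hfin, h0, h1, h2, h3, h4, hbelow, habove, hP, hcP, hoP, fun P _ _ _ bP ⟨e⟩ =>
    exists_isBoundaryGluing_sphereFour_of_diffeomorph_regularSublevel hf h h3 h4 hbelow habove P bP e⟩

end Closing

/-! ### The boundary of the lower half: every integral surgery presenting it has framing `0` -/

section Framing

/-- **The boundary of the model lower half is `S² × S¹`, so every integral surgery presenting it
has framing `0`.**  For the splitting `S⁴ = {f ≤ c} ∪ {c ≤ f}` above, the boundary of
`P₀ = {f ≤ c}` is identified with the boundary of the compact connected orientable
`(1,1)`-handlebody `V₀ = {c ≤ f}` (`RegularSublevel.splitDiffeomorph`), which is `S² × S¹`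
(`nonempty_diffeomorph_boundary_sphereTwo_prod_of_handleCount_one_one_holds`; Kirby 1989, Ch. I
§2, p. 8); hence `H₁(∂P₀; ℤ) ≅ ℤ` and an integral surgery `∂P₀ = S³ₙ(K)` must have `n = 0`
(`IsIntegralSurgery.nonempty_addEquiv_singularHomology_one_int_iff`; Gabai 1987, Remark 8.5:
`H₁(S³ₙ(K)) ≅ ℤ/n`).  This is the homological half of the certification of the model's
attaching data for clause (ii) of `exists_framedKnot_of_hasHandleDecomposition_oneZeroOne`.
[cite: Kirby1989, Ch. I §2, p. 8] [cite: GabaiJDG1987, Remark 8.5] -/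
theorem eq_zero_of_isIntegralSurgery_boundary_regularSublevel
    {f : (Metric.sphere (0 : EuclideanSpace ℝ (Fin 5)) 1) → ℝ} {c : ℝ} (hf : IsMorse (𝓡 4) f)
    (h : IsRegularLevel (𝓡 4) f c)
    (h3 : (criticalSetOfIndex (𝓡 4) f 3).ncard = 1) (h4 : (criticalSetOfIndex (𝓡 4) f 4).ncard = 1)
    (hbelow : ∀ x, IsMCriticalPt (𝓡 4) f x → morseIndex (𝓡 4) f x ≤ 2 → f x < c)
    (habove : ∀ x, IsMCriticalPt (𝓡 4) f x → 3 ≤ morseIndex (𝓡 4) f x → c < f x)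
    {K : Knot} {n : ℤ}
    (hsurg : IsIntegralSurgery (𝓡 3) (RegularSublevel.boundaryData h).carrier K n) : n = 0 := by
  haveI := connectedSpace_regularSuperlevel_of_twoThree hf h h4 habove
  have hY : IsOrientable (𝓡 4) (Metric.sphere (0 : EuclideanSpace ℝ (Fin 5)) 1) :=
    isOrientable_sphere_holds 4
  obtain ⟨e⟩ := nonempty_diffeomorph_boundary_sphereTwo_prod_of_handleCount_one_one_holds
    (RegularSuperlevel h) (hasHandleDecomposition_regularSuperlevel_oneOne hf h h3 h4 hbelow habove)
    (RegularSublevel.isOrientable h.const_sub hY) (RegularSublevel.boundaryData h.const_sub)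
  let θ := (RegularSublevel.splitDiffeomorph h).trans e
  have hH : Nonempty (Literature.AlgebraicTopology.SingularHomology.singularHomology ℤ ℤ
      (RegularSublevel.boundaryData h).carrier 1 ≃+ ℤ) := by
    obtain ⟨g⟩ := nonempty_addEquiv_singularHomology_one_sphereTwo_prod_sphereOne
    exact ⟨(Literature.AlgebraicTopology.SingularHomology.singularHomology.equivOfHomeomorph ℤ ℤ
      θ.toHomeomorph 1).toAddEquiv.trans g⟩
  exact hsurg.nonempty_addEquiv_singularHomology_one_int_iff.1 hH

end Framing

end Literature.Topology.FourManifolds
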